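import Summits.ResolutionOfSingularities.ResolutionOfSingularities.Theorems.EquisingularLiftEquisingularLiftLinearCentreKill
import HarnessLib

/-!
# [OURS · L1 W4.5(b)] EL♮ helper (R1, part 1) — LINEAR CENTRES OVER `O`: the graded surjection killing an ARBITRARY set
# of variables, its kernel, and its base change to the special fibre

Cell res-hironaka, LADDER-RESOLUTION rung L (D-0089), slot W4.5(b), crux `Theses.EquisingularLift.EquisingularLiftNat`
(stmt-ResolutionOfSingularities-20038), object **(R1)** of res-L1-w45b-plan-1's ORDERS 2026-08-27T05:49:16Z («linear centres over
`O` in the EL♮ ambient»), `--supports stmt-ResolutionOfSingularities-20038 --as helper`. NOT a statement of any manuscript; OURS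
structural algebra. AI-written; AI review is weaker than expert review.

The p-tree files `…LinearCentreKill.lean` / `…LinearCentreLift.lean` (crux `EquisingularLift`) carry the coordinate subspace
`V(x_{r+1}, …, x_{r+m}) ⊆ ℙ^{r+m}` as `ker (Proj f)` for the graded surjection killing the LAST `m` variables. The EL♮ consumers
need OTHER coordinate subspaces (R2, res-D-pv-022: `V(x₀, x₁) ⊂ ℙ³`; T-ISO-0, res-D-pv-029: sections), so this file re-runs
that algebra for an ARBITRARY injective `e : Fin (r+1) → Fin (N+1)` listing the SURVIVING variables, the kill map being carried
DEF-FREE as a (graded) ring homomorphism `f : R[x_0..x_N] → R[x_0..x_r]` with `f (C a) = C a`, `f (X (e j)) = X j`,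
`f (X i) = 0` (`i ∉ range e`): `exists_kill_ringHom` / `exists_kill` (existence, with the `Proj.map` hypothesis);
`kill_rename`, `kill_surjective`, `ker_kill` (`= (x_i : i ∉ range e)`, via `Literature…ker_aeval_ite_eq_span`),
`isHomogeneous_kill`, `irrelevant_le_map_kill`; `map_comp_kill`, `exists_ker_lift` (coefficient map `π : O → k`);
`ker_projMap_kill_eq_comap` — **`ker (Proj f_k) = ker (Proj f_O) · 𝒪_{ℙ_k}`** along the special fibre `g = Proj (map π)`
(Hartshorne II Prop. 5.9 / Ex. 3.12 on the charts `D₊(x_i)`; transcribed from `StrataSplit.LinearCentre.comap_ker_projMap_kill`);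
`awayMap_algebraMap_kill`, `projMap_kill_comp_structureMap` — `Proj f_O : ℙ^r_O → ℙ^N_O` is a morphism over `Spec O`.

References: [Hartshorne1977, II Prop. 5.9, Ex. 3.12 (a)]; the p-tree files named above (OURS, index only).
-/

set_option linter.dupNamespace false -- mandated namespace `Summit.<Summit>.<Problem>` of this single-conjunct summit

noncomputable section

open CategoryTheory CategoryTheory.Limits AlgebraicGeometry TopologicalSpace
open MvPolynomial HomogeneousLocalization
open Literature.AlgebraicGeometry.Resolution
open AlgebraicGeometry.Scheme.IdealSheafData
open Summit.ResolutionOfSingularities.ResolutionOfSingularities.Cruxes.EquisingularLift.StrataSplit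

attribute [local instance] MvPolynomial.gradedAlgebra
attribute [local instance] Literature.AlgebraicGeometry.Motives.ProjBaseChange.algebraBase

namespace Summit.ResolutionOfSingularities.ResolutionOfSingularities.Cruxes.EquisingularLiftNat

namespace LinearCentre

universe u

/-! ## Algebra of the graded surjection killing the variables outside `range e` -/

section Kill

variable {R : Type u} [CommRing R] {N r : ℕ} (e : Fin (r + 1) → Fin (N + 1)) (he : Function.Injective e)
  (f : MvPolynomial (Fin (N + 1)) R →+* MvPolynomial (Fin (r + 1)) R)
  (hfC : ∀ a : R, f (C a) = C a) (hfe : ∀ j : Fin (r + 1), f (X (e j)) = X j)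
  (hf0 : ∀ i : Fin (N + 1), i ∉ Set.range e → f (X i) = 0)

include he in
/-- **The kill map exists** (ring homomorphism): `x_{e j} ↦ x_j`, `x_i ↦ 0` (`i ∉ range e`), constants fixed. [folklore] -/
theorem exists_kill_ringHom : ∃ f : MvPolynomial (Fin (N + 1)) R →+* MvPolynomial (Fin (r + 1)) R,
    (∀ a : R, f (C a) = C a) ∧ (∀ j : Fin (r + 1), f (X (e j)) = X j) ∧
      (∀ i : Fin (N + 1), i ∉ Set.range e → f (X i) = 0) := by
  classical
  refine ⟨(aeval fun i : Fin (N + 1) =>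
      if h : i ∈ Set.range e then (X (Classical.choose h) : MvPolynomial (Fin (r + 1)) R) else 0).toRingHom,
    fun a => by simp, fun j => ?_, fun i hi => ?_⟩
  · have h : e j ∈ Set.range e := ⟨j, rfl⟩
    simp only [AlgHom.toRingHom_eq_coe, RingHom.coe_coe, aeval_X, dif_pos h]
    congr 1
    exact he (Classical.choose_spec h)
  · simp only [AlgHom.toRingHom_eq_coe, RingHom.coe_coe, aeval_X, dif_neg hi]

include hfC hfe in
/-- Killing after renaming along `e` is the identity (a section). [folklore] -/
theorem kill_rename (q : MvPolynomial (Fin (r + 1)) R) : f (rename e q) = q := by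
  have h : f.comp (rename e : MvPolynomial (Fin (r + 1)) R →ₐ[R] _).toRingHom = RingHom.id _ := by
    refine MvPolynomial.ringHom_ext (fun a => ?_) (fun j => ?_)
    · simp only [RingHom.coe_comp, Function.comp_apply, AlgHom.toRingHom_eq_coe, RingHom.coe_coe, rename_C,
        RingHom.id_apply]
      exact hfC a
    · simp only [RingHom.coe_comp, Function.comp_apply, AlgHom.toRingHom_eq_coe, RingHom.coe_coe, rename_X,
        RingHom.id_apply]
      exact hfe j
  exact congrArg (fun g : MvPolynomial (Fin (r + 1)) R →+* _ => g q) h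

include hfC hfe in
/-- The kill map is surjective (private copy; the castLE case is `StrataSplit.LinearCentre.kill_surjective`). [folklore] -/
private theorem kill_surjective : Function.Surjective f :=
  fun q => ⟨_, kill_rename e f hfC hfe q⟩

include he hfC hfe hf0 in
/-- **The kernel of the kill map is the ideal of the killed variables** `(x_i : i ∉ range e)`. [folklore] -/
theorem ker_kill : RingHom.ker f = Ideal.span (X '' (Set.range e)ᶜ) := by
  classical
  set s : Set (Fin (N + 1)) := (Set.range e)ᶜ with hs
  have hcomp : (aeval (fun i : Fin (N + 1) => if i ∈ s then (0 : MvPolynomial (Fin (N + 1)) R) else X i)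
      : MvPolynomial (Fin (N + 1)) R →ₐ[R] _).toRingHom =
      (rename e : MvPolynomial (Fin (r + 1)) R →ₐ[R] _).toRingHom.comp f := by
    refine MvPolynomial.ringHom_ext (fun a => ?_) (fun i => ?_)
    · simp only [AlgHom.toRingHom_eq_coe, RingHom.coe_coe, aeval_C, RingHom.coe_comp, Function.comp_apply,
        MvPolynomial.algebraMap_eq]
      rw [hfC, rename_C]
    · simp only [AlgHom.toRingHom_eq_coe, RingHom.coe_coe, aeval_X, RingHom.coe_comp, Function.comp_apply]
      by_cases hi : i ∈ Set.range e
      · obtain ⟨j, rfl⟩ := hi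
        have his : e j ∉ s := fun h => h ⟨j, rfl⟩
        rw [if_neg his, hfe, rename_X]
      · have his : i ∈ s := hi
        rw [if_pos his, hf0 i hi, map_zero]
  rw [← Literature.RingTheory.MvPolynomial.ker_aeval_ite_eq_span s]
  ext q
  simp only [RingHom.mem_ker]
  have happ := congrArg (fun g : MvPolynomial (Fin (N + 1)) R →+* _ => g q) hcomp
  simp only [AlgHom.toRingHom_eq_coe, RingHom.coe_coe, RingHom.coe_comp, Function.comp_apply] at happ
  rw [happ]
  exact ⟨fun h => by rw [h, map_zero], fun h => rename_injective _ he (by rw [h, map_zero])⟩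

include hfC in
/-- The kill map is the evaluation at its values on the variables. [folklore] -/
theorem kill_eq_aeval : f = (aeval fun i : Fin (N + 1) => f (X i)).toRingHom := by
  exact MvPolynomial.ringHom_ext (fun a => by rw [hfC]; simp) (fun i => by simp)

include hfC hfe hf0 in
/-- The kill map preserves homogeneity (every variable goes to a variable or to zero). [folklore] -/
theorem isHomogeneous_kill {q : MvPolynomial (Fin (N + 1)) R} {n : ℕ} (hq : q.IsHomogeneous n) :
    (f q).IsHomogeneous n := by
  rw [kill_eq_aeval f hfC]
  have h1 := hq.aeval (fun i : Fin (N + 1) => f (X i)) (n := 1) (fun i => by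
    by_cases hi : i ∈ Set.range e
    · obtain ⟨j, rfl⟩ := hi
      rw [hfe]
      exact isHomogeneous_X R _
    · rw [hf0 i hi]
      exact isHomogeneous_zero _ _ _)
  rw [one_mul] at h1
  exact h1

include hfe in
/-- The irrelevant ideal of the target is generated by the image of the irrelevant ideal of the source (the hypothesis of
Mathlib's `Proj.map`), for the kill map viewed as a graded homomorphism. [folklore] -/
theorem irrelevant_le_map_kill (g : homogeneousSubmodule (Fin (N + 1)) R →+*ᵍ homogeneousSubmodule (Fin (r + 1)) R)
    (hg : ∀ q, g q = f q) :
    HomogeneousIdeal.irrelevant (homogeneousSubmodule (Fin (r + 1)) R) ≤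
      (HomogeneousIdeal.irrelevant (homogeneousSubmodule (Fin (N + 1)) R)).map g := by
  rw [← toIdeal_le_toIdeal_iff, HomogeneousIdeal.toIdeal_map]
  refine (irrelevant_le_span r R).trans (Ideal.span_le.mpr ?_)
  rintro _ ⟨j, rfl⟩
  have hXj : (X j : MvPolynomial (Fin (r + 1)) R) = g (X (e j)) := by
    rw [hg, hfe]
  rw [SetLike.mem_coe, hXj]
  exact Ideal.mem_map_of_mem _ (HomogeneousIdeal.mem_irrelevant_of_mem _ one_pos (isHomogeneous_X R _))

include he in
/-- **The kill map as a graded homomorphism, with the `Proj.map` hypothesis** — existence, def-free. [folklore] -/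
theorem exists_kill : ∃ (g : homogeneousSubmodule (Fin (N + 1)) R →+*ᵍ homogeneousSubmodule (Fin (r + 1)) R)
    (_ : HomogeneousIdeal.irrelevant (homogeneousSubmodule (Fin (r + 1)) R) ≤
      (HomogeneousIdeal.irrelevant (homogeneousSubmodule (Fin (N + 1)) R)).map g),
    (∀ a : R, g (C a) = C a) ∧ (∀ j : Fin (r + 1), g (X (e j)) = X j) ∧
      (∀ i : Fin (N + 1), i ∉ Set.range e → g (X i) = 0) := by
  obtain ⟨f, hfC, hfe, hf0⟩ := exists_kill_ringHom (R := R) e he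
  let g : homogeneousSubmodule (Fin (N + 1)) R →+*ᵍ homogeneousSubmodule (Fin (r + 1)) R :=
    ⟨f, fun h => isHomogeneous_kill e f hfC hfe hf0 h⟩
  exact ⟨g, irrelevant_le_map_kill e f hfe g (fun _ => rfl), hfC, hfe, hf0⟩

end Kill

/-! ## Base change of the kill map along `π : O → k` -/

section Square

variable {O k : Type u} [CommRing O] [CommRing k] (π : O →+* k) {N r : ℕ} (e : Fin (r + 1) → Fin (N + 1))
  (fO : MvPolynomial (Fin (N + 1)) O →+* MvPolynomial (Fin (r + 1)) O)
  (hfOC : ∀ a : O, fO (C a) = C a) (hfOe : ∀ j : Fin (r + 1), fO (X (e j)) = X j)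
  (hfO0 : ∀ i : Fin (N + 1), i ∉ Set.range e → fO (X i) = 0)
  (fk : MvPolynomial (Fin (N + 1)) k →+* MvPolynomial (Fin (r + 1)) k)
  (hfkC : ∀ a : k, fk (C a) = C a) (hfke : ∀ j : Fin (r + 1), fk (X (e j)) = X j)
  (hfk0 : ∀ i : Fin (N + 1), i ∉ Set.range e → fk (X i) = 0)

include hfOC hfOe hfO0 hfkC hfke hfk0 in
/-- The kill maps over `O` and `k` commute with `π` (private; cf. `StrataSplit.LinearCentre.map_comp_kill`). [folklore] -/
private theorem map_comp_kill : (MvPolynomial.map π).comp fO = fk.comp (MvPolynomial.map π) := by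
  refine MvPolynomial.ringHom_ext (fun a => ?_) (fun i => ?_)
  · simp only [RingHom.coe_comp, Function.comp_apply]
    rw [hfOC, map_C, map_C, hfkC]
  · simp only [RingHom.coe_comp, Function.comp_apply]
    rw [map_X]
    by_cases hi : i ∈ Set.range e
    · obtain ⟨j, rfl⟩ := hi
      rw [hfOe, hfke, map_X]
    · rw [hfO0 i hi, hfk0 i hi, map_zero]

include hfOC hfOe hfO0 hfkC hfke hfk0 in
/-- **Kernel elements lift**: a homogeneous element of `ker f_k` lifts along a surjective `π` to a homogeneous element of
`ker f_O` of the same degree (lift arbitrarily, then subtract the renamed kill). [folklore] -/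
theorem exists_ker_lift (hπ : Function.Surjective π) {n : ℕ} (a : MvPolynomial (Fin (N + 1)) k)
    (ha : a.IsHomogeneous n) (hak : fk a = 0) :
    ∃ b : MvPolynomial (Fin (N + 1)) O, b.IsHomogeneous n ∧ fO b = 0 ∧ MvPolynomial.map π b = a := by
  obtain ⟨b, hb, hba⟩ := Summit.ResolutionOfSingularities.ResolutionOfSingularities.Cruxes.EquisingularLift.StrataSplit.LinearCentre.exists_homogeneous_lift π hπ a ha
  refine ⟨b - rename e (fO b), ?_, ?_, ?_⟩
  · exact hb.sub ((isHomogeneous_kill e fO hfOC hfOe hfO0 hb).rename_isHomogeneous)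
  · rw [map_sub, kill_rename e fO hfOC hfOe, sub_self]
  · rw [map_sub, hba, map_rename, sub_eq_self]
    have h := congrArg (fun g : MvPolynomial (Fin (N + 1)) O →+* _ => g b)
      (map_comp_kill π e fO hfOC hfOe hfO0 fk hfkC hfke hfk0)
    simp only [RingHom.coe_comp, Function.comp_apply] at h
    rw [h, hba, hak, map_zero]

end Square

/-! ## The kernel ideal sheaf of the linear subspace: base change to the special fibre -/

section Comap

variable {O k : Type} [CommRing O] [CommRing k] (π : O →+* k) (hπ : Function.Surjective π) {N r : ℕ}
  (e : Fin (r + 1) → Fin (N + 1))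
  (φ : (homogeneousSubmodule (Fin (N + 1)) O) →+*ᵍ (homogeneousSubmodule (Fin (N + 1)) k))
  (hφ : ∀ q, φ q = MvPolynomial.map π q)
  (hφ' : HomogeneousIdeal.irrelevant (homogeneousSubmodule (Fin (N + 1)) k) ≤
    (HomogeneousIdeal.irrelevant (homogeneousSubmodule (Fin (N + 1)) O)).map φ)
  (fO : (homogeneousSubmodule (Fin (N + 1)) O) →+*ᵍ (homogeneousSubmodule (Fin (r + 1)) O))
  (hfO' : HomogeneousIdeal.irrelevant (homogeneousSubmodule (Fin (r + 1)) O) ≤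
    (HomogeneousIdeal.irrelevant (homogeneousSubmodule (Fin (N + 1)) O)).map fO)
  (hfOC : ∀ a : O, fO (C a) = C a) (hfOe : ∀ j : Fin (r + 1), fO (X (e j)) = X j)
  (hfO0 : ∀ i : Fin (N + 1), i ∉ Set.range e → fO (X i) = 0)
  (fk : (homogeneousSubmodule (Fin (N + 1)) k) →+*ᵍ (homogeneousSubmodule (Fin (r + 1)) k))
  (hfk' : HomogeneousIdeal.irrelevant (homogeneousSubmodule (Fin (r + 1)) k) ≤
    (HomogeneousIdeal.irrelevant (homogeneousSubmodule (Fin (N + 1)) k)).map fk)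
  (hfkC : ∀ a : k, fk (C a) = C a) (hfke : ∀ j : Fin (r + 1), fk (X (e j)) = X j)
  (hfk0 : ∀ i : Fin (N + 1), i ∉ Set.range e → fk (X i) = 0)

include hφ hfOC hfOe hfO0 hfkC hfke hfk0 hπ in
/-- **The `O`-linear centre restricts to the `k`-linear centre on the special fibre**: for the closed immersion
`g = Proj φ : ℙ^N_k → ℙ^N_O` (`φ` the coefficient map of a surjection `π : O → k`) and the kill maps `f_O`, `f_k` of the
same set of variables, the inverse image ideal sheaf of `ker (Proj f_O)` along `g` is `ker (Proj f_k)`. (`≤`: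
`Proj f_k ≫ g = Proj φ_r ≫ Proj f_O`; `≥`: over the chart `D₊(x_i)` the ideal `(ker f_k)_{(x_i)}` is spanned by fractions
`a/x_iⁿ`, `a ∈ ker f_k` homogeneous, which lift to `ker f_O`.) Transcribed from
`StrataSplit.LinearCentre.comap_ker_projMap_kill` for an arbitrary set of killed variables.
[cite: Hartshorne1977, II Prop. 5.9 and Ex. 3.12 (a)] -/
theorem ker_projMap_kill_eq_comap :
    (Proj.map fk hfk').ker = (Proj.map fO hfO').ker.comap (Proj.map φ hφ') := by
  classical
  refine Eq.symm ?_
  -- the coefficient map on the small projective space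
  let φr : (homogeneousSubmodule (Fin (r + 1)) O) →+*ᵍ (homogeneousSubmodule (Fin (r + 1)) k) :=
    ⟨MvPolynomial.map π, fun h ↦ h.map π⟩
  have hφr : ∀ q, φr q = MvPolynomial.map π q := fun _ ↦ rfl
  have hφr' := ProjectiveAmbientFibre.irrelevant_le_map_gradedMap π φr hφr
  have hsq : fk.comp φ = φr.comp fO := by
    have hc := map_comp_kill π e fO.toRingHom (fun a => hfOC a) (fun j => hfOe j) (fun i hi => hfO0 i hi)
      fk.toRingHom (fun a => hfkC a) (fun j => hfke j) (fun i hi => hfk0 i hi)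
    refine GradedRingHom.ext fun q => ?_
    have h := congrArg (fun ψ : MvPolynomial (Fin (N + 1)) O →+* MvPolynomial (Fin (r + 1)) k => ψ q) hc
    simp only [RingHom.coe_comp, Function.comp_apply] at h
    rw [GradedRingHom.comp_apply, GradedRingHom.comp_apply, hφ, hφr]
    exact h.symm
  refine le_antisymm ?_ ?_
  · -- `≤`: formal, from `Proj f_k ≫ g = Proj φ_r ≫ Proj f_O`
    refine le_map_iff_comap_le.mp ?_
    rw [map_ker, ← Proj.map_comp φ fk hφ' hfk',
      Summit.ResolutionOfSingularities.ResolutionOfSingularities.Cruxes.EquisingularLift.StrataSplit.LinearCentre.projMap_congr' hsq (HomogeneousIdeal.irrelevant_le_map_comp hφ' hfk')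
        (HomogeneousIdeal.irrelevant_le_map_comp hfO' hφr'),
      Proj.map_comp fO φr hfO' hφr']
    exact Scheme.Hom.le_ker_comp _ _
  · -- `≥`: chartwise on the cover `D₊(φ x_i) = D₊(x_i)` of `ℙ_k`
    have hXO : ∀ i : Fin (N + 1), (X i : MvPolynomial (Fin (N + 1)) O) ∈ (homogeneousSubmodule (Fin (N + 1)) O) 1 :=
      fun i => isHomogeneous_X O i
    have hXk : ∀ i : Fin (N + 1), φ (X i) ∈ (homogeneousSubmodule (Fin (N + 1)) k) 1 := fun i => φ.map_mem (hXO i)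
    let U : Fin (N + 1) → (Proj (homogeneousSubmodule (Fin (N + 1)) k)).affineOpens := fun i =>
      ⟨Proj.basicOpen (homogeneousSubmodule (Fin (N + 1)) k) (φ (X i)),
        Proj.isAffineOpen_basicOpen (homogeneousSubmodule (Fin (N + 1)) k) (φ (X i)) (hXk i) one_pos⟩
    have hU : ⨆ i, (U i : (Proj (homogeneousSubmodule (Fin (N + 1)) k)).Opens) = ⊤ := by
      have h := Proj.iSup_basicOpen_eq_top (homogeneousSubmodule (Fin (N + 1)) k)
        (fun i : Fin (N + 1) => (X i : MvPolynomial (Fin (N + 1)) k)) (irrelevant_le_span N k)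
      have hfun : (fun i => (U i : (Proj (homogeneousSubmodule (Fin (N + 1)) k)).Opens)) =
          fun i => Proj.basicOpen (homogeneousSubmodule (Fin (N + 1)) k) (X i) := by
        funext i
        change Proj.basicOpen (homogeneousSubmodule (Fin (N + 1)) k) (φ (X i)) =
          Proj.basicOpen (homogeneousSubmodule (Fin (N + 1)) k) (X i)
        rw [hφ, map_X]
      change iSup (fun i => (U i : (Proj (homogeneousSubmodule (Fin (N + 1)) k)).Opens)) = ⊤
      rw [hfun]
      exact h
    refine le_of_iSup_eq_top U hU fun i => ?_
    let UO : (Proj (homogeneousSubmodule (Fin (N + 1)) O)).affineOpens :=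
      ⟨Proj.basicOpen (homogeneousSubmodule (Fin (N + 1)) O) (X i),
        Proj.isAffineOpen_basicOpen (homogeneousSubmodule (Fin (N + 1)) O) (X i) (hXO i) one_pos⟩
    have hle : (U i : (Proj (homogeneousSubmodule (Fin (N + 1)) k)).Opens) ≤
        Proj.map φ hφ' ⁻¹ᵁ (UO : (Proj (homogeneousSubmodule (Fin (N + 1)) O)).Opens) := by
      change Proj.basicOpen (homogeneousSubmodule (Fin (N + 1)) k) (φ (X i)) ≤
        Proj.map φ hφ' ⁻¹ᵁ Proj.basicOpen (homogeneousSubmodule (Fin (N + 1)) O) (X i)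
      rw [Proj.map_preimage_basicOpen]
    have hsurjk : Function.Surjective fk :=
      kill_surjective e fk.toRingHom (fun a => hfkC a) (fun j => hfke j)
    have hsurjO : Function.Surjective fO :=
      kill_surjective e fO.toRingHom (fun a => hfOC a) (fun j => hfOe j)
    rw [ker_projMap_ideal_basicOpen fk hfk' hsurjk one_pos (hXk i),
      ideal_comap_of_le (Proj.map φ hφ') (Proj.map fO hfO').ker UO (U i) hle,
      ker_projMap_ideal_basicOpen fO hfO' hsurjO one_pos (hXO i)]
    -- generators `a / (φ x_i)ⁿ` with `a ∈ ker f_k` homogeneous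
    unfold awayIdeal
    rw [Ideal.map_span]
    refine Ideal.span_le.mpr ?_
    rintro _ ⟨x, ⟨n, a, ha, hak, rfl⟩, rfl⟩
    have ha1 : a.IsHomogeneous n := by simpa [smul_eq_mul] using ha
    have hak0 : fk.toRingHom a = 0 := RingHom.mem_ker.mp hak
    obtain ⟨b, hb, hbO, hba⟩ := exists_ker_lift π e fO.toRingHom (fun a => hfOC a) (fun j => hfOe j)
      (fun i hi => hfO0 i hi) fk.toRingHom (fun a => hfkC a) (fun j => hfke j) (fun i hi => hfk0 i hi) hπ a ha1 hak0
    have hbO' : b ∈ RingHom.ker fO := RingHom.mem_ker.mpr hbO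
    have hbn : b ∈ (homogeneousSubmodule (Fin (N + 1)) O) (n • 1) := by simpa [smul_eq_mul] using hb
    -- the upstairs section `b / x_iⁿ` lies in the kernel ideal and maps to `a / (φ x_i)ⁿ`
    have hup : (Proj.awayToSection (homogeneousSubmodule (Fin (N + 1)) O) (X i)).hom
          (Away.mk (homogeneousSubmodule (Fin (N + 1)) O) (hXO i) n b hbn) ∈
        Ideal.map (Proj.awayToSection (homogeneousSubmodule (Fin (N + 1)) O) (X i)).hom
          (awayIdeal (homogeneousSubmodule (Fin (N + 1)) O) (hXO i) (RingHom.ker fO)) :=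
      Ideal.mem_map_of_mem _ (mk_mem_awayIdeal (homogeneousSubmodule (Fin (N + 1)) O) (hXO i) hbn hbO')
    have himg : ((Proj.map φ hφ').appLE (UO : (Proj (homogeneousSubmodule (Fin (N + 1)) O)).Opens)
          (U i : (Proj (homogeneousSubmodule (Fin (N + 1)) k)).Opens) hle).hom
          ((Proj.awayToSection (homogeneousSubmodule (Fin (N + 1)) O) (X i)).hom
            (Away.mk (homogeneousSubmodule (Fin (N + 1)) O) (hXO i) n b hbn)) =
        (Proj.awayToSection (homogeneousSubmodule (Fin (N + 1)) k) (φ (X i))).hom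
          (Away.mk (homogeneousSubmodule (Fin (N + 1)) k) (hXk i) n a ha) := by
      have h := congrArg (fun ψ => ψ.hom (Away.mk (homogeneousSubmodule (Fin (N + 1)) O) (hXO i) n b hbn))
        (Proj.awayToSection_comp_appLE φ hφ' (hXO i))
      simp only [CommRingCat.hom_comp, RingHom.comp_apply, CommRingCat.hom_ofHom] at h
      rw [h, Away.map_mk]
      congr 1
      apply val_injective
      simp only [Away.val_mk]
      congr 1
      rw [hφ, hba]
    rw [SetLike.mem_coe, ← himg]
    exact Ideal.mem_map_of_mem _ hup

end Comap

/-! ## The structure morphism of the linear subspace `ℙ^r_O → ℙ^N_O → Spec O` -/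

section StructureMap

variable {O : Type} [CommRing O] {N r : ℕ} (e : Fin (r + 1) → Fin (N + 1))
  (fO : (homogeneousSubmodule (Fin (N + 1)) O) →+*ᵍ (homogeneousSubmodule (Fin (r + 1)) O))
  (hfO' : HomogeneousIdeal.irrelevant (homogeneousSubmodule (Fin (r + 1)) O) ≤
    (HomogeneousIdeal.irrelevant (homogeneousSubmodule (Fin (N + 1)) O)).map fO)
  (hfOC : ∀ a : O, fO (C a) = C a) (hfOe : ∀ j : Fin (r + 1), fO (X (e j)) = X j)

open Literature.AlgebraicGeometry.Motives.ProjBaseChange in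
include hfOC in
/-- The kill map on homogeneous localizations is compatible with the `O`-algebra structures (transcribed from
`…LinearCentreLift.awayMap_algebraMap_kill`). [folklore] -/
theorem awayMap_algebraMap_kill (s : MvPolynomial (Fin (N + 1)) O) (a : O) :
    Away.map fO s (algebraMap O (Away (homogeneousSubmodule (Fin (N + 1)) O) s) a) =
      algebraMap O (Away (homogeneousSubmodule (Fin (r + 1)) O) (fO s)) a := by
  apply val_injective
  rw [val_algebraMap, algebraMap_eq', Away.map, map_mk, val_mk]
  simp only [SetLike.GradeZero.coe_algebraMap, MvPolynomial.algebraMap_eq]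
  rw [IsScalarTower.algebraMap_apply O (MvPolynomial (Fin (r + 1)) O) (Localization _),
    ← Localization.mk_algebraMap]
  congr 1
  · simp [hfOC, MvPolynomial.algebraMap_eq]
  · ext; simp

include hfOC hfOe in
/-- **`Proj` of the kill map is a morphism over `Spec O`**: `ℙ^r_O → ℙ^N_O → Spec O` is the structure morphism of
`ℙ^r_O` (checked on the charts `D₊(x_j) = D₊(f_O x_{e j})`). Transcribed from
`…LinearCentreLift.projMap_kill_comp_structureMap`. [folklore] -/
theorem projMap_kill_comp_structureMap :
    Proj.map fO hfO' ≫ (Proj.toSpecZero (homogeneousSubmodule (Fin (N + 1)) O) ≫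
        Spec.map (CommRingCat.ofHom (algebraMap O ((homogeneousSubmodule (Fin (N + 1)) O) 0)))) =
      Proj.toSpecZero (homogeneousSubmodule (Fin (r + 1)) O) ≫
        Spec.map (CommRingCat.ofHom (algebraMap O ((homogeneousSubmodule (Fin (r + 1)) O) 0))) := by
  have hXO : ∀ i : Fin (N + 1), (X i : MvPolynomial (Fin (N + 1)) O) ∈ (homogeneousSubmodule (Fin (N + 1)) O) 1 :=
    fun i => isHomogeneous_X O i
  have hspan : (HomogeneousIdeal.irrelevant (homogeneousSubmodule (Fin (r + 1)) O)).toIdeal ≤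
      Ideal.span (Set.range fun j : Fin (r + 1) => fO (X (e j))) := by
    have hfun : (fun j : Fin (r + 1) => fO (X (e j))) = fun j => X j := funext hfOe
    rw [hfun]
    exact irrelevant_le_span r O
  let 𝒰 := Proj.affineOpenCoverOfIrrelevantLESpan (homogeneousSubmodule (Fin (r + 1)) O)
    (fun j : Fin (r + 1) => fO (X (e j))) (m := fun _ => 1) (fun j => fO.map_mem (hXO _)) (fun _ => one_pos) hspan
  refine 𝒰.openCover.hom_ext _ _ fun j => ?_
  change Proj.awayι (homogeneousSubmodule (Fin (r + 1)) O) (fO (X (e j))) (fO.map_mem (hXO _)) one_pos ≫ _ =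
    Proj.awayι (homogeneousSubmodule (Fin (r + 1)) O) (fO (X (e j))) (fO.map_mem (hXO _)) one_pos ≫ _
  have hring : (Away.map fO (X (e j))).comp
        ((fromZeroRingHom (homogeneousSubmodule (Fin (N + 1)) O) _).comp
          (algebraMap O ((homogeneousSubmodule (Fin (N + 1)) O) 0))) =
      (fromZeroRingHom (homogeneousSubmodule (Fin (r + 1)) O) _).comp
        (algebraMap O ((homogeneousSubmodule (Fin (r + 1)) O) 0)) := by
    refine RingHom.ext fun a => ?_
    exact awayMap_algebraMap_kill fO hfOC (X (e j)) a
  rw [Proj.awayι_comp_map_assoc fO hfO' one_pos (X (e j)) (hXO _),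
    Proj.awayι_toSpecZero_assoc, Proj.awayι_toSpecZero_assoc, ← Spec.map_comp, ← Spec.map_comp,
    ← Spec.map_comp, ← CommRingCat.ofHom_comp, ← CommRingCat.ofHom_comp, ← CommRingCat.ofHom_comp, hring]

end StructureMap

end LinearCentre

end Summit.ResolutionOfSingularities.ResolutionOfSingularities.Cruxes.EquisingularLiftNat

end
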